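import Literature.MathematicalPhysics.QuantumFieldTheory.Balaban1983to89.B9Thm313WholeLeftZ
import Literature.MathematicalPhysics.QuantumFieldTheory.Balaban1983to89.B9Thm313WholeEntry2HolderCut

/-!
# `Balaban1983to89.B9Thm313WholeGGEntriesMembers` — T. Bałaban, *Propagators for lattice gauge theories in a background field*, Commun. Math. Phys. **99** (1985)
# 389–434 [`Balaban1985BackgroundPropagators`], Theorem 3.13 p. 426 (row 21 of the N06 table): the three sup entries (3.42)₁,₂,₃ of 𝔊 = G₁𝔓\* ((3.153)) AT THE
# G₁-MEMBER LINE — the entries of G₁, G₁D, G₁Q\*, ∇_UG₁, ∇_UG₁Q\*, (∇_UG₀(Δ′_π+Δ⁽²⁾_π))(G₁D), G₁∇\*_U are HYPOTHESES (free constants), the rest is the letter algebra of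
# (3.152)–(3.153); NO step `G₀(Δ′_π + Δ⁽²⁾_π)` on a raw sup class is consumed

[4] = T. Bałaban, *Propagators and renormalization transformations for lattice gauge theories. II*, Commun. Math. Phys. **96** (1984) 223–250 [`Balaban1984PropagatorsII`].
statement-level skeleton of published theorems with citation tags; proofs where landed; nothing here is a claim about the Yang–Mills mass gap.

THE PRINT.  Thm 3.13 p. 426: *"the operator 𝔊 … satisfies (3.42)–(3.47) … This follows from (3.152), (3.153), Theorem 3.12 and the estimates for G′, R"*; (3.153):
𝔊 = G₁ − G₁D(RD\*G₁) − G₁Q\*(QG₁Q\*)⁻¹QG₁ (the tree's `Identities.eq153`, `GG_comp_eq`, `D_GG_eq`); (3.152): RD\*G₁ = RG′D\*, G₁DR = DG′R (`Ids3152`); Thm 3.12 p. 423: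
the members of G₁ = Σ G₀((Δ′_π+Δ⁽²⁾_π)G₀)ⁿ are those of G₀ read over the induction state of Theorem 3.3's type.

WHY THIS FILE (cell `pub-ymgap`, node N06, bundle F7 rows 20–21, seat dag-n06-l g27; programme P-U8S step S5a — the row-21 half of the FLAG №8 (U8) cure of record, director-ym
№272).  The landed row-21 sup readers (ym-inputs-p04's `B9Thm313WholeSupReadersCut.GG_entry0∕1_cut_of_letters`, `B9Thm313WholeEntry2HolderCut.GG_entry2_holderCut_of_letters`)
derive the G₁-level entries INSIDE, from the one-step field `Step.step1` (`hK : G₀(Δ′_π+Δ⁽²⁾_π) : 𝔠⁽ᵖ⁾ → 𝔠⁽ᵖ⁾`) and `LeftStep.stepD1` — the raw-state species dag-n06-l LOCATED as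
uninhabitable beyond print (LOCATED-U8′, `U8S-PROGRAMME-MEMO.md`).  Over the REGULAR state those entries come instead from `B9Thm312WholeStepRegular.hasMaj_right_of_stepS` +
readings and `B9Thm312WholeMembersRegular.hasMaj_left_rightS`; so THIS FILE re-issues the three readers CUT AT THE G₁-MEMBER LINE, proofs verbatim below that line:
* ★★ `GG_entry0_of_members` — (3.42)₁ for 𝔊 from `G₁ : 𝔠⁽⁰⁾ → 𝔠⁽²⁾` (A₁), `G₁D : 𝔠_W⁽¹⁾ → 𝔠⁽²⁾`, `G₁Q\* : Z_{w} → 𝔠⁽²⁾` (A₃) and the letters `rgd2 c1_2 q2`: constant `const313 A₁ A₃ B₃ c`;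
* ★★ `GG_entry1_of_members` — (3.42)₂ for ∇_U𝔊 from the same three, `∇_UG₁ : 𝔠⁽⁰⁾ → 𝔠_Y⁽¹⁾` (C_L), the product member `(∇_UG₀(Δ′_π+Δ⁽²⁾_π))∘(G₁D) : 𝔠_W⁽¹⁾ → 𝔠_Y⁽¹⁾` (A_T, rate ρ′+σ),
  `∇_UG₁Q\* : Z_w → 𝔠_Y⁽¹⁾` (A_{DQ}, rate ρ′+σ) and the letters `rgd2 c1_2 q2` + `Letters313DZ` (`rgdH dgDH` through the Hölder class `bH`): constant
  `C_L + κ_H B₃²c + A_T B₃ c + A_{DQ}(B₃(B₃A₁c)c)c`;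
* ★★ `GG_entry2_of_members` — (3.42)₃ for 𝔊∇\*_U from `G₁∇\*_U : 𝔠_Y⁽⁰⁾ → 𝔠⁽¹⁾` (A₁), `G₁Q\* : Z_{len·w} → 𝔠⁽¹⁾` (A₃), the letters `c1_1 q1`, the (3.152)-cut middle letters `gXH`
  (G₁∇\*_U : Y⁰ → bXH) and `wGp` (D·G′·R·D\* : bXH → 𝔠⁽¹⁾): constant `A₁ + κ_{XH}B_WB_Xc + A₃(B₃(B₃A₁c)c)c`.
HONEST SCOPE.  Letter algebra over hypothesis schemas of printed species; every analytic member is a HYPOTHESIS; nothing of [B9]∕[4] asserted; no pin, no certificate edit;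
COUNT-NEUTRAL; N06 NOT discharged; nothing continuum ∕ OS positivity ∕ mass gap.  Cell `pub-ymgap` (HUMAN RULING D-0062), Track A node N06 [B9], seat `pub-ymgap-dag-n06-l` (g27),
2026-08-29.  NEW file; nothing landed is modified.
-/

namespace Literature.MathematicalPhysics.QuantumFieldTheory.Balaban1983to89.B9Thm313WholeGGEntriesMembers

open Literature.MathematicalPhysics.QuantumFieldTheory.Balaban1983to89
open Finset Filter B6RandomWalk B6RandomWalkHom B9Thm34Ext B9Thm37GlueCor36 B11SectG B9SectDSup
open B9Thm37AllNorms B9Thm37AllNormsInstances B9FromB6 B9FromB6ModelSignsOn B9SectBStepWhole B9Thm312Whole B9Thm312WholeLeaf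
open B9Thm312WholeLeft B9Thm313Whole B9Thm313WholeLeft B9Thm313WholeZ B9Thm313WholeLeftZ B9Thm313WholeRgdFrom3152 B9Thm313WholeEntry2HolderCut

noncomputable section

section OneMember

variable {g : B9.Geometry} {B : B9.Backgrounds} {X Y Z W : Type}
variable [Fintype X] [Fintype Y] [Fintype Z] [Fintype W] [Fintype g.Site]
variable {R₀ : ℝ} {H₀ : Prop}

/-! ## §1 The sup entry (3.42)₁ of 𝔊 at the G₁-member line -/

omit [Fintype Y] in
/-- ★★ **THEOREM 3.13, ENTRY (3.42)₁ FOR 𝔊 AT THE G₁-MEMBER LINE** (`GG_entry0_cut_of_letters` with the three right entries of G₁ as HYPOTHESES): from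
`G₁ : 𝔠⁽⁰⁾ → 𝔠⁽²⁾` (`A₁e^{−ρd}`), `G₁D : 𝔠_W⁽¹⁾ → 𝔠⁽²⁾` and `G₁Q\* : Z_w → 𝔠⁽²⁾` (`A₃e^{−ρd}`) — over the regular state these are `hasMaj_right_of_stepS` + the sup reading —
and the letters `rgd2` (RD\*G₁ : 𝔠⁽⁰⁾ → 𝔠_W⁽¹⁾), `c1_2` ((QG₁Q\*)⁻¹ : Z² → Z_w), `q2` (Q : 𝔠⁽²⁾ → Z²) at (B₃, δ₃), with (3.153): |(𝔊λ)(x)| ≦ `const313 A₁ A₃ B₃ c`·(Lʲη)²e^{−ρ′d(y,y′)}|λ|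
for every ρ′ ≧ 0 with ρ′ + 3σ ≦ ρ ≦ δ₃.
[cite: Balaban1985BackgroundPropagators, Thm 3.13 p.426 + (3.153) p.426 + (3.138) p.423 + (3.42) p.397; Balaban1984PropagatorsII, (2.52)–(2.56) pp.232–233 + Lemma 2.1 (2.61) p.234] -/
theorem GG_entry0_of_members (hG : GeoOK g) {𝔬 : Ops g B X Y Z W} {U : B.Cfg}
    {A₁ A₃ B₃ δ₃ ρ ρ' σ c : ℝ} (hrow : RowSum (toB6 g R₀ H₀) σ c) (hc : 0 ≤ c)
    (hA₁ : 0 ≤ A₁) (hA₃ : 0 ≤ A₃) (hB₃ : 0 ≤ B₃) (hσ : 0 ≤ σ) (hρ' : 0 ≤ ρ') (hρ'ρ : ρ' + 3 * σ ≤ ρ) (hρ₃ : ρ ≤ δ₃)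
    (hG1 : HasMaj (cNorm R₀ H₀ 𝔬.blk hG.lenle 0) (cNorm R₀ H₀ 𝔬.blk hG.lenle 2) (𝔬.G1 U ∘ₗ LinearMap.id)
      (fun a b => A₁ * Real.exp (-(ρ * g.dist a b))))
    (hGD : HasMaj (cNorm R₀ H₀ 𝔬.blkW hG.lenle 1) (cNorm R₀ H₀ 𝔬.blk hG.lenle 2) (𝔬.G1 U ∘ₗ 𝔬.Dv U)
      (fun a b => A₃ * Real.exp (-(ρ * g.dist a b))))
    (wZ : g.Site → ℝ) (hwZ : ∀ y, 0 < wZ y)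
    (hGQ : HasMaj (weightNorm (BlockNorm.ofBlocks (toB6 g R₀ H₀) 𝔬.blkZ) wZ fun y => (hwZ y).le) (cNorm R₀ H₀ 𝔬.blk hG.lenle 2)
      (𝔬.G1 U ∘ₗ 𝔬.Qstar U) (fun a b => A₃ * Real.exp (-(ρ * g.dist a b))))
    (hLrgd2 : HasMaj (cNorm R₀ H₀ 𝔬.blk hG.lenle 0) (cNorm R₀ H₀ 𝔬.blkW hG.lenle 1) (𝔬.R U ∘ₗ 𝔬.Dvstar U ∘ₗ 𝔬.G1 U ∘ₗ LinearMap.id)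
      (fun a b => B₃ * Real.exp (-(δ₃ * g.dist a b))))
    (hLc1_2 : HasMaj (cNorm R₀ H₀ 𝔬.blkZ hG.lenle 2) (weightNorm (BlockNorm.ofBlocks (toB6 g R₀ H₀) 𝔬.blkZ) wZ fun y => (hwZ y).le) (𝔬.C1 U)
      (fun a b => B₃ * Real.exp (-(δ₃ * g.dist a b))))
    (hLq2 : HasMaj (cNorm R₀ H₀ 𝔬.blk hG.lenle 2) (cNorm R₀ H₀ 𝔬.blkZ hG.lenle 2) (𝔬.Q U) (fun a b => B₃ * Real.exp (-(δ₃ * g.dist a b))))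
    (hI : Identities 𝔬 U) :
    HasMajorant (g := toB6 g R₀ H₀) 𝔬.blk (𝔬.GG U)
      (fun a b => const313 A₁ A₃ B₃ c * g.len a ^ 2 * Real.exp (-(ρ' * g.dist a b))) := by
  have htri : Triangle254 (toB6 g R₀ H₀) := fun a b c => hG.tri a b c
  -- QG₁ : 𝔠⁽⁰⁾ → Z², rate ρ′ + 2σ
  have hQG : HasMaj (cNorm R₀ H₀ 𝔬.blk hG.lenle 0) (cNorm R₀ H₀ 𝔬.blkZ hG.lenle 2) (𝔬.Q U ∘ₗ (𝔬.G1 U ∘ₗ LinearMap.id))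
      (fun a b => (cNorm R₀ H₀ 𝔬.blk hG.lenle 2 (X := X)).κ * B₃ * A₁ * c * Real.exp (-((ρ' + 2 * σ) * g.dist a b))) :=
    hasMaj_comp_exp htri hG.dnn hrow hB₃ hA₁ (by linarith) (by linarith) (by linarith) hLq2 hG1
  simp only [cNorm_κ, one_mul] at hQG
  -- all six letters at the rate ρ′ + 2σ
  have hδ₁ : ρ' + 2 * σ ≤ ρ := by linarith
  have hδ₃ : ρ' + 2 * σ ≤ δ₃ := by linarith
  have h := hasMaj_frakG_classes (bA := cNorm R₀ H₀ 𝔬.blk hG.lenle 0) (bC := cNorm R₀ H₀ 𝔬.blk hG.lenle 2)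
    (bP := cNorm R₀ H₀ 𝔬.blkW hG.lenle 1) (bQ₁ := cNorm R₀ H₀ 𝔬.blkZ hG.lenle 2)
    (bQ₂ := weightNorm (BlockNorm.ofBlocks (toB6 g R₀ H₀) 𝔬.blkZ) wZ fun y => (hwZ y).le)
    htri hG.dnn hrow hA₁ hA₃ hB₃ hA₃ hB₃ (mul_nonneg (mul_nonneg hB₃ hA₁) hc) hρ' hσ le_rfl
    (hG1.of_rate_le hG.dnn hA₁ hδ₁) (hGD.of_rate_le hG.dnn hA₃ hδ₁) (hLrgd2.of_rate_le hG.dnn hB₃ hδ₃)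
    (hGQ.of_rate_le hG.dnn hA₃ hδ₁) (hLc1_2.of_rate_le hG.dnn hB₃ hδ₃) (hQG.of_rate_le hG.dnn
      (mul_nonneg (mul_nonneg hB₃ hA₁) hc) le_rfl)
  rw [← GG_comp_eq hI LinearMap.id, LinearMap.comp_id] at h
  simp only [cNorm_κ, weightNorm_ofBlocks_κ, one_mul] at h
  have hC0 : 0 ≤ const313 A₁ A₃ B₃ c := const313_nonneg hA₁ hA₃ hB₃ hc
  have h2 : HasMaj (cNorm R₀ H₀ 𝔬.blk hG.lenle 0) (cNorm R₀ H₀ 𝔬.blk hG.lenle 2) (𝔬.GG U)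
      (fun a b => const313 A₁ A₃ B₃ c * Real.exp (-(ρ' * g.dist a b))) :=
    h.mono fun a b => le_of_eq rfl
  have h' := hasMajorantHom_of_hasMaj_cNorm hG (fun a b => mul_nonneg hC0 (Real.exp_nonneg _)) h2
  rw [hasMajorantHom_iff] at h'
  refine hasMajorant_mono (g := toB6 g R₀ H₀) 𝔬.blk h' fun a b => le_of_eq ?_
  simp only [wt, pow_zero, inv_one, mul_one]
  ring

/-! ## §2 The left sup entry (3.42)₂ of 𝔊 at the G₁-member line -/

/-- ★★ **THEOREM 3.13, ENTRY (3.42)₂ FOR ∇_U𝔊 AT THE G₁-MEMBER LINE** (`GG_entry1_cut_of_letters` with the G₁-level members as HYPOTHESES): from `G₁ : 𝔠⁽⁰⁾ → 𝔠⁽²⁾` (A₁, ρ),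
`∇_UG₁ : 𝔠⁽⁰⁾ → 𝔠_Y⁽¹⁾` (C_L, ρ), the product member `(∇_UG₀(Δ′_π+Δ⁽²⁾_π))∘(G₁D) : 𝔠_W⁽¹⁾ → 𝔠_Y⁽¹⁾` (A_T, ρ′+σ — over the regular state: the state field ∇_UG₀T : 𝔖₂ → 𝔠_Y⁽¹⁾
after the right entry G₁D INTO 𝔖₂), `∇_UG₁Q\* : Z_w → 𝔠_Y⁽¹⁾` (A_{DQ}, ρ′+σ) and the letters `rgd2 c1_2 q2` (B₃, δ₃), `Letters313DZ` (`rgdH`, `dgDH` through the Hölder class `bH`),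
(3.138)'s resolvent identity (for TERM B's split (∇G₁D)(RD\*G₁) = (∇G₀D)(RD\*G₁) + ((∇G₀T)(G₁D))(RD\*G₁)) and (3.153):
|(∇_U𝔊λ)(x)| ≦ (C_L + κ_H B₃²c + A_T B₃c + A_{DQ}(B₃(B₃A₁c)c)c)·Lʲη·e^{−ρ′d(y,y′)}|λ|, every ρ′ ≧ 0 with ρ′ + 3σ ≦ ρ ≦ δ₃.
[cite: Balaban1985BackgroundPropagators, Thm 3.13 p.426 + (3.152)–(3.153) p.426 + (3.138) p.423 + (3.42)–(3.44) pp.397–398 + (3.49) p.399; Balaban1984PropagatorsII, (2.54) p.233 + Lemma 2.1 (2.61) p.234] -/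
theorem GG_entry1_of_members (hG : GeoOK g) {𝔬 : Ops g B X Y Z W} {U : B.Cfg}
    {bH : BlockNorm (toB6 g R₀ H₀) (W → ℝ)}
    {A₁ CL AT ADQ B₃ δ₃ ρ ρ' σ c : ℝ} (hrow : RowSum (toB6 g R₀ H₀) σ c) (hc : 0 ≤ c)
    (hA₁ : 0 ≤ A₁) (hCL : 0 ≤ CL) (hAT : 0 ≤ AT) (hADQ : 0 ≤ ADQ) (hB₃ : 0 ≤ B₃) (hσ : 0 ≤ σ) (hρ' : 0 ≤ ρ')
    (hρ'ρ : ρ' + 3 * σ ≤ ρ) (hρ₃ : ρ ≤ δ₃)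
    (hG1 : HasMaj (cNorm R₀ H₀ 𝔬.blk hG.lenle 0) (cNorm R₀ H₀ 𝔬.blk hG.lenle 2) (𝔬.G1 U ∘ₗ LinearMap.id)
      (fun a b => A₁ * Real.exp (-(ρ * g.dist a b))))
    (hD1 : HasMaj (cNorm R₀ H₀ 𝔬.blk hG.lenle 0) (cNorm R₀ H₀ 𝔬.blkY hG.lenle 1) (𝔬.D U ∘ₗ 𝔬.G1 U ∘ₗ LinearMap.id)
      (fun y y' => CL * Real.exp (-(ρ * g.dist y y'))))
    (hGDT : HasMaj (cNorm R₀ H₀ 𝔬.blkW hG.lenle 1) (cNorm R₀ H₀ 𝔬.blkY hG.lenle 1)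
      ((𝔬.D U ∘ₗ 𝔬.G0 U ∘ₗ (𝔬.Tpi U + 𝔬.T2 U)) ∘ₗ (𝔬.G1 U ∘ₗ 𝔬.Dv U))
      (fun y y' => AT * Real.exp (-((ρ' + σ) * g.dist y y'))))
    (wZ : g.Site → ℝ) (hwZ : ∀ y, 0 < wZ y)
    (hD1Q : HasMaj (weightNorm (BlockNorm.ofBlocks (toB6 g R₀ H₀) 𝔬.blkZ) wZ fun y => (hwZ y).le)
      (cNorm R₀ H₀ 𝔬.blkY hG.lenle 1) (𝔬.D U ∘ₗ 𝔬.G1 U ∘ₗ 𝔬.Qstar U)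
      (fun y y' => ADQ * Real.exp (-((ρ' + σ) * g.dist y y'))))
    (hLrgd2 : HasMaj (cNorm R₀ H₀ 𝔬.blk hG.lenle 0) (cNorm R₀ H₀ 𝔬.blkW hG.lenle 1) (𝔬.R U ∘ₗ 𝔬.Dvstar U ∘ₗ 𝔬.G1 U ∘ₗ LinearMap.id)
      (fun a b => B₃ * Real.exp (-(δ₃ * g.dist a b))))
    (hLc1_2 : HasMaj (cNorm R₀ H₀ 𝔬.blkZ hG.lenle 2) (weightNorm (BlockNorm.ofBlocks (toB6 g R₀ H₀) 𝔬.blkZ) wZ fun y => (hwZ y).le) (𝔬.C1 U)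
      (fun a b => B₃ * Real.exp (-(δ₃ * g.dist a b))))
    (hLq2 : HasMaj (cNorm R₀ H₀ 𝔬.blk hG.lenle 2) (cNorm R₀ H₀ 𝔬.blkZ hG.lenle 2) (𝔬.Q U) (fun a b => B₃ * Real.exp (-(δ₃ * g.dist a b))))
    (hLD : Letters313DZ 𝔬 R₀ H₀ hG wZ hwZ B₃ δ₃ bH U) (hI : Identities 𝔬 U) :
    HasMajorantHom (g := toB6 g R₀ H₀) 𝔬.blk 𝔬.blkY (𝔬.D U ∘ₗ 𝔬.GG U)
      (fun a b => (CL + bH.κ * B₃ * B₃ * c + AT * B₃ * c + ADQ * (B₃ * (B₃ * A₁ * c) * c) * c) *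
        g.len a * Real.exp (-(ρ' * g.dist a b))) := by
  have hfix1 := fix_of_inverses hI.invG0' hI.invG1
  have htri : Triangle254 (toB6 g R₀ H₀) := fun a b c => hG.tri a b c
  -- TERM B = (∇G₁D)(RD*G₁) = (∇G₀D)(RD*G₁) + ((∇G₀T₁)(G₁D))(RD*G₁): the first summand through the Hölder class `bH`, the second through W¹ (`rgd2`)
  have hρ'₃ : ρ' ≤ δ₃ := by linarith
  have hρ'σ₃ : ρ' + σ ≤ δ₃ := by linarith
  have hB1 : HasMaj (cNorm R₀ H₀ 𝔬.blk hG.lenle 0) (cNorm R₀ H₀ 𝔬.blkY hG.lenle 1)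
      ((𝔬.D U ∘ₗ 𝔬.G0 U ∘ₗ 𝔬.Dv U) ∘ₗ (𝔬.R U ∘ₗ 𝔬.Dvstar U ∘ₗ 𝔬.G1 U ∘ₗ LinearMap.id))
      (fun y y' => bH.κ * B₃ * B₃ * c * Real.exp (-(ρ' * g.dist y y'))) :=
    hasMaj_comp_exp htri hG.dnn hrow hB₃ hB₃ hρ' hρ'₃ hρ'σ₃ hLD.dgDH hLD.rgdH
  have hB2 : HasMaj (cNorm R₀ H₀ 𝔬.blk hG.lenle 0) (cNorm R₀ H₀ 𝔬.blkY hG.lenle 1)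
      (((𝔬.D U ∘ₗ 𝔬.G0 U ∘ₗ (𝔬.Tpi U + 𝔬.T2 U)) ∘ₗ (𝔬.G1 U ∘ₗ 𝔬.Dv U)) ∘ₗ
        (𝔬.R U ∘ₗ 𝔬.Dvstar U ∘ₗ 𝔬.G1 U ∘ₗ LinearMap.id))
      (fun y y' => (cNorm R₀ H₀ 𝔬.blkW hG.lenle 1 (X := W)).κ * AT * B₃ * c * Real.exp (-(ρ' * g.dist y y'))) :=
    hasMaj_comp_exp htri hG.dnn hrow hAT hB₃ hρ' hρ'₃ le_rfl hGDT hLrgd2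
  simp only [cNorm_κ, one_mul] at hB2
  have eB : (𝔬.D U ∘ₗ 𝔬.G1 U ∘ₗ 𝔬.Dv U) ∘ₗ (𝔬.R U ∘ₗ 𝔬.Dvstar U ∘ₗ 𝔬.G1 U ∘ₗ LinearMap.id) =
      (𝔬.D U ∘ₗ 𝔬.G0 U ∘ₗ 𝔬.Dv U) ∘ₗ (𝔬.R U ∘ₗ 𝔬.Dvstar U ∘ₗ 𝔬.G1 U ∘ₗ LinearMap.id) +
        (((𝔬.D U ∘ₗ 𝔬.G0 U ∘ₗ (𝔬.Tpi U + 𝔬.T2 U)) ∘ₗ (𝔬.G1 U ∘ₗ 𝔬.Dv U)) ∘ₗ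
          (𝔬.R U ∘ₗ 𝔬.Dvstar U ∘ₗ 𝔬.G1 U ∘ₗ LinearMap.id)) := by
    rw [comp_fix_left_right (𝔬.D U) (𝔬.Dv U) hfix1, LinearMap.add_comp]
  have hB := hB1.add hB2
  rw [← eB] at hB
  -- TERM C = (∇G₁Q*)((QG₁Q*)⁻¹QG₁) through the sup classes Z², Z_w
  have hQG : HasMaj (cNorm R₀ H₀ 𝔬.blk hG.lenle 0) (cNorm R₀ H₀ 𝔬.blkZ hG.lenle 2) (𝔬.Q U ∘ₗ (𝔬.G1 U ∘ₗ LinearMap.id))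
      (fun a b => (cNorm R₀ H₀ 𝔬.blk hG.lenle 2 (X := X)).κ * B₃ * A₁ * c * Real.exp (-((ρ' + 2 * σ) * g.dist a b))) :=
    hasMaj_comp_exp htri hG.dnn hrow hB₃ hA₁ (by linarith) (by linarith) (by linarith) hLq2 hG1
  simp only [cNorm_κ, one_mul] at hQG
  have hK₁ : 0 ≤ B₃ * A₁ * c := mul_nonneg (mul_nonneg hB₃ hA₁) hc
  have hCQG : HasMaj (cNorm R₀ H₀ 𝔬.blk hG.lenle 0) (weightNorm (BlockNorm.ofBlocks (toB6 g R₀ H₀) 𝔬.blkZ) wZ fun y => (hwZ y).le)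
      (𝔬.C1 U ∘ₗ (𝔬.Q U ∘ₗ (𝔬.G1 U ∘ₗ LinearMap.id)))
      (fun a b => (cNorm R₀ H₀ 𝔬.blkZ hG.lenle 2 (X := Z)).κ * B₃ * (B₃ * A₁ * c) * c * Real.exp (-((ρ' + σ) * g.dist a b))) :=
    hasMaj_comp_exp htri hG.dnn hrow hB₃ hK₁ (by linarith) (by linarith) (by linarith) hLc1_2 hQG
  simp only [cNorm_κ, one_mul] at hCQG
  have hK₂ : 0 ≤ B₃ * (B₃ * A₁ * c) * c := mul_nonneg (mul_nonneg hB₃ hK₁) hc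
  have hC : HasMaj (cNorm R₀ H₀ 𝔬.blk hG.lenle 0) (cNorm R₀ H₀ 𝔬.blkY hG.lenle 1)
      ((𝔬.D U ∘ₗ 𝔬.G1 U ∘ₗ 𝔬.Qstar U) ∘ₗ (𝔬.C1 U ∘ₗ (𝔬.Q U ∘ₗ (𝔬.G1 U ∘ₗ LinearMap.id))))
      (fun y y' => (weightNorm (BlockNorm.ofBlocks (toB6 g R₀ H₀) 𝔬.blkZ) wZ fun y => (hwZ y).le).κ * ADQ *
        (B₃ * (B₃ * A₁ * c) * c) * c * Real.exp (-(ρ' * g.dist y y'))) :=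
    hasMaj_comp_exp htri hG.dnn hrow hADQ hK₂ hρ' (by linarith) le_rfl hD1Q hCQG
  simp only [weightNorm_ofBlocks_κ, one_mul] at hC
  -- assembling (3.153) differentiated on the left
  have h := ((hD1.of_rate_le hG.dnn hCL (by linarith : ρ' ≤ ρ)).sub hB).sub hC
  rw [← D_GG_eq hI] at h
  have hC0 : 0 ≤ CL + bH.κ * B₃ * B₃ * c + AT * B₃ * c + ADQ * (B₃ * (B₃ * A₁ * c) * c) * c :=
    add_nonneg (add_nonneg (add_nonneg hCL (mul_nonneg (mul_nonneg (mul_nonneg bH.κ_nonneg hB₃) hB₃) hc))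
      (mul_nonneg (mul_nonneg hAT hB₃) hc)) (mul_nonneg (mul_nonneg hADQ hK₂) hc)
  have h2 : HasMaj (cNorm R₀ H₀ 𝔬.blk hG.lenle 0) (cNorm R₀ H₀ 𝔬.blkY hG.lenle 1) (𝔬.D U ∘ₗ 𝔬.GG U)
      (fun a b => (CL + bH.κ * B₃ * B₃ * c + AT * B₃ * c + ADQ * (B₃ * (B₃ * A₁ * c) * c) * c) *
        Real.exp (-(ρ' * g.dist a b))) :=
    h.mono fun a b => le_of_eq (by simp only [toB6_dist]; ring)
  have h' := hasMajorantHom_of_hasMaj_cNorm hG (fun a b => mul_nonneg hC0 (Real.exp_nonneg _)) h2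
  refine hasMajorantHom_mono (g := toB6 g R₀ H₀) 𝔬.blk 𝔬.blkY h' fun a b => le_of_eq ?_
  simp only [wt, pow_zero, pow_one, inv_one, mul_one]
  ring

/-! ## §3 The right sup entry (3.42)₃ of 𝔊 at the G₁-member line, middle term by (3.152) -/

/-- ★★ **THEOREM 3.13, ENTRY (3.42)₃ FOR 𝔊∇\*_U AT THE G₁-MEMBER LINE** (`GG_entry2_holderCut_of_letters` with the two right entries as HYPOTHESES): from
`G₁∇\*_U : 𝔠_Y⁽⁰⁾ → 𝔠⁽¹⁾` (A₁, ρ — over the regular state: the (P1′) producer G₀∇\*_U INTO 𝔖₁, `StepS` at 𝔖₁ and the sup reading), `G₁Q\* : Z_{len·w} → 𝔠⁽¹⁾` (A₃, ρ), the letters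
`c1_1` ((QG₁Q\*)⁻¹ : Z¹ → Z_{len·w}), `q1` (Q : 𝔠⁽¹⁾ → Z¹) at (B₃, δ₃), the (3.152)-cut middle letters `gXH` (G₁∇\*_U : Y⁰ → `bXH`, B_X) and `wGp` (D·G′·R·D\* : `bXH` → 𝔠⁽¹⁾, B_W):
|(𝔊∇\*_Uμ)(x)| ≦ (A₁ + κ_{XH}B_WB_Xc + A₃(B₃(B₃A₁c)c)c)·Lʲη·e^{−ρ′d(y,y′)}|μ| for every ρ′ ≧ 0 with ρ′ + 3σ ≦ ρ ≦ δ₃.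
[cite: Balaban1985BackgroundPropagators, Thm 3.13 p.426 + (3.152)–(3.153) p.426 + (3.138) p.423 + (3.42)–(3.44) pp.397–398; Balaban1984PropagatorsII, (2.52)–(2.56) pp.232–233 + Lemma 2.1 (2.61) p.234] -/
theorem GG_entry2_of_members (hG : GeoOK g) {𝔬 : Ops g B X Y Z W} {U : B.Cfg}
    {Gp : B.Cfg → Module.End ℝ (W → ℝ)} {bXH : BlockNorm (toB6 g R₀ H₀) (X → ℝ)}
    {A₁ A₃ B₃ BW BX δ₃ ρ ρ' σ c : ℝ} (hrow : RowSum (toB6 g R₀ H₀) σ c) (hc : 0 ≤ c)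
    (hA₁ : 0 ≤ A₁) (hA₃ : 0 ≤ A₃) (hB₃ : 0 ≤ B₃) (hBW : 0 ≤ BW) (hBX : 0 ≤ BX) (hσ : 0 ≤ σ) (hρ' : 0 ≤ ρ')
    (hρ'ρ : ρ' + 3 * σ ≤ ρ) (hρ₃ : ρ ≤ δ₃)
    (hG1 : HasMaj (cNorm R₀ H₀ 𝔬.blkY hG.lenle 0) (cNorm R₀ H₀ 𝔬.blk hG.lenle 1) (𝔬.G1 U ∘ₗ 𝔬.Dstar U)
      (fun a b => A₁ * Real.exp (-(ρ * g.dist a b))))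
    {wZ : g.Site → ℝ} {hwZ : ∀ y, 0 < wZ y}
    (hGQ : HasMaj (weightNorm (BlockNorm.ofBlocks (toB6 g R₀ H₀) 𝔬.blkZ) (fun y => g.len y * wZ y) fun y => (wZlen_pos hG hwZ y).le)
      (cNorm R₀ H₀ 𝔬.blk hG.lenle 1) (𝔬.G1 U ∘ₗ 𝔬.Qstar U) (fun a b => A₃ * Real.exp (-(ρ * g.dist a b))))
    (hc1_1 : HasMaj (cNorm R₀ H₀ 𝔬.blkZ hG.lenle 1)
      (weightNorm (BlockNorm.ofBlocks (toB6 g R₀ H₀) 𝔬.blkZ) (fun y => g.len y * wZ y) fun y => (wZlen_pos hG hwZ y).le) (𝔬.C1 U)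
      (fun a b => B₃ * Real.exp (-(δ₃ * g.dist a b))))
    (hq1 : HasMaj (cNorm R₀ H₀ 𝔬.blk hG.lenle 1) (cNorm R₀ H₀ 𝔬.blkZ hG.lenle 1) (𝔬.Q U)
      (fun a b => B₃ * Real.exp (-(δ₃ * g.dist a b))))
    (hXH : HasMaj (cNorm R₀ H₀ 𝔬.blkY hG.lenle 0) bXH (𝔬.G1 U ∘ₗ 𝔬.Dstar U)
      (fun a b => BX * Real.exp (-(δ₃ * g.dist a b))))
    (hW : HasMaj bXH (cNorm R₀ H₀ 𝔬.blk hG.lenle 1) (𝔬.Dv U ∘ₗ Gp U ∘ₗ 𝔬.R U ∘ₗ 𝔬.Dvstar U)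
      (fun a b => BW * Real.exp (-(δ₃ * g.dist a b))))
    (hI : Identities 𝔬 U) (h152 : Ids3152 𝔬 Gp U) :
    HasMajorantHom (g := toB6 g R₀ H₀) 𝔬.blkY 𝔬.blk (𝔬.GG U ∘ₗ 𝔬.Dstar U)
      (fun a b => (A₁ + bXH.κ * BW * BX * c + A₃ * (B₃ * (B₃ * A₁ * c) * c) * c) * g.len a *
        Real.exp (-(ρ' * g.dist a b))) := by
  have htri : Triangle254 (toB6 g R₀ H₀) := fun a b c => hG.tri a b c
  -- QG₁∇* : Y⁰ → Z¹, rate ρ′ + 2σ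
  have hQG : HasMaj (cNorm R₀ H₀ 𝔬.blkY hG.lenle 0) (cNorm R₀ H₀ 𝔬.blkZ hG.lenle 1) (𝔬.Q U ∘ₗ (𝔬.G1 U ∘ₗ 𝔬.Dstar U))
      (fun a b => (cNorm R₀ H₀ 𝔬.blk hG.lenle 1 (X := X)).κ * B₃ * A₁ * c * Real.exp (-((ρ' + 2 * σ) * g.dist a b))) :=
    hasMaj_comp_exp htri hG.dnn hrow hB₃ hA₁ (by linarith) (by linarith) (by linarith) hq1 hG1
  simp only [cNorm_κ, one_mul] at hQG
  have hδ₁ : ρ' + 2 * σ ≤ ρ := by linarith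
  have hδ₃ : ρ' + 2 * σ ≤ δ₃ := by linarith
  have h := hasMaj_frakG_classes (bA := cNorm R₀ H₀ 𝔬.blkY hG.lenle 0) (bC := cNorm R₀ H₀ 𝔬.blk hG.lenle 1)
    (bP := bXH) (bQ₁ := cNorm R₀ H₀ 𝔬.blkZ hG.lenle 1)
    (bQ₂ := weightNorm (BlockNorm.ofBlocks (toB6 g R₀ H₀) 𝔬.blkZ) (fun y => g.len y * wZ y) fun y => (wZlen_pos hG hwZ y).le)
    htri hG.dnn hrow hA₁ hBW hBX hA₃ hB₃ (mul_nonneg (mul_nonneg hB₃ hA₁) hc) hρ' hσ le_rfl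
    (hG1.of_rate_le hG.dnn hA₁ hδ₁) (hW.of_rate_le hG.dnn hBW hδ₃) (hXH.of_rate_le hG.dnn hBX hδ₃)
    (hGQ.of_rate_le hG.dnn hA₃ hδ₁) (hc1_1.of_rate_le hG.dnn hB₃ hδ₃) (hQG.of_rate_le hG.dnn
      (mul_nonneg (mul_nonneg hB₃ hA₁) hc) le_rfl)
  rw [← GG_comp_Dstar_eq_3152 hI h152 (𝔬.Dstar U)] at h
  simp only [cNorm_κ, weightNorm_ofBlocks_κ, one_mul] at h
  have hC0 : 0 ≤ A₁ + bXH.κ * BW * BX * c + A₃ * (B₃ * (B₃ * A₁ * c) * c) * c :=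
    add_nonneg (add_nonneg hA₁ (mul_nonneg (mul_nonneg (mul_nonneg bXH.κ_nonneg hBW) hBX) hc))
      (mul_nonneg (mul_nonneg hA₃ (mul_nonneg (mul_nonneg hB₃ (mul_nonneg (mul_nonneg hB₃ hA₁) hc)) hc)) hc)
  have h2 : HasMaj (cNorm R₀ H₀ 𝔬.blkY hG.lenle 0) (cNorm R₀ H₀ 𝔬.blk hG.lenle 1) (𝔬.GG U ∘ₗ 𝔬.Dstar U)
      (fun a b => (A₁ + bXH.κ * BW * BX * c + A₃ * (B₃ * (B₃ * A₁ * c) * c) * c) * Real.exp (-(ρ' * g.dist a b))) :=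
    h.mono fun a b => le_of_eq rfl
  have h' := hasMajorantHom_of_hasMaj_cNorm hG (fun a b => mul_nonneg hC0 (Real.exp_nonneg _)) h2
  refine hasMajorantHom_mono (g := toB6 g R₀ H₀) 𝔬.blkY 𝔬.blk h' fun a b => le_of_eq ?_
  simp only [wt, pow_zero, pow_one, inv_one, mul_one]
  ring

end OneMember

end

end Literature.MathematicalPhysics.QuantumFieldTheory.Balaban1983to89.B9Thm313WholeGGEntriesMembers
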